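import Summits.BirchSwinnertonDyer.BirchSwinnertonDyer.Theorems.PrintCf2SplitBadTwoUnrLocalLift
import Summits.BirchSwinnertonDyer.BirchSwinnertonDyer.Theorems.PrintCf2SplitBadTwoRestrictedSelmerNoFiniteSubmoduleOfH2
import Summits.BirchSwinnertonDyer.BirchSwinnertonDyer.Theorems.PrintCf2SplitBadTwoLineLocallyTrivialAwayP
import HarnessLib

/-!
# Crux `PrintCf2.SplitBadTwoRankOneOfFacts` (stmt-BirchSwinnertonDyer-20368), skeleton v13, stub S3d `stub_strictDefectAtVbar_two`, class (iii),
# file 2 of 3: THE BASE LIFT (β)_nr FOR `S_M(K_∞) = H¹_{𝓕_nr}(K_∞, M)` and `(S_nr)_Γ = 0` (generic; JSW17 Lemma 3.3.3 / Greenberg pp. 122–125)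

Cell `bsd-print-cf2`, EXTRA WIDTH seat `bsd-line-cf2-p1-w4` g11 (prover-bsd-line-cf2-p1-w4-g11-0); `--supports stmt-BirchSwinnertonDyer-20368`
(helper, Theses-free). HONEST FRAMING: nothing here closes the crux or a registered stub; BSD is not proved by any of this; no summit statement
is proved by this seat. No definition, no named fact, no `sorry`. CONDITIONAL (displayed hypotheses): the level-`K` local surjectivity (LS) (exactly the hypothesis of -w4 g9's
`RestrictedSelmerPair.baseLift_of_locSurj`), hul «unramified ⟹ locally trivial over the line away from `p`» (on road α: -w6 g4
`LineLocallyTrivial.awayKer_eq_unramifiedKer_of_frame`), the LOCAL input h𝓛 at `𝔮` of file 1, and (§2) «`H²(Γ_K, M) = 0`».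

WHY (S3d, LEAD rulings 01:48:57Z / 02:16:44Z / 02:30:44Z; -w3 g11's spine p690534, 02:47:23Z). With the spine `n′ = n + χ_Γ(Q)`,
`Q := S_{W*}(K*_∞) ⧸ 𝔖_{v̄}(K*_∞, W*)`, the number `e_δ` of S3d is `log₂ #Q^Γ − log₂ #Q_Γ`; on class (iii) (`d ≡ 3 (8)`, `14 (16)`) `Q` embeds
`Γ`-equivariantly in the local defect group `𝓛 ≅ W* ≅ ℚ₂/ℤ₂(u)`, `v₂(u − 1) = 2`, so `e_δ ∈ {0, 2}` according as `Q` is finite or all of `𝓛`, and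
class-uniformity IS «`Q` infinite» ⟺ «`Q_Γ = 0`». `Q_Γ` is a quotient of `(S_nr)_Γ`, and this series of three files proves **`(S_nr)_Γ = 0`** WITHOUT
any global-to-local surjectivity over the line (GV 2000 Prop. 2.1, absent from the tree): exactly as B17 obtained `𝔖_Γ = 0` (-w4 g8
`forall_finite_eq_bot_of_subsingleton_H2_of_baseLift`, -w4 g9 `baseLift_of_locSurj`), from (β)_nr «every `c ∈ H¹(K_∞, M)` with `conj_γ c − c ∈ S_nr`
is congruent mod `S_nr` to a class restricted from `K`» and `H¹(K_∞, M)_Γ = 0` (`H²(Γ_K, M) = 0`, X11b procyclic descent). The ONE new ingredient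
w.r.t. the strict version is the local lift at the distinguished place `𝔮` for the UNRAMIFIED condition: `x := res_{D″} c` is `D_𝔮`-invariant only
modulo `𝓛`; the displayed local hypothesis h𝓛 («`conj_δ − 1` is onto `𝓛` for `δ ∈ D_𝔮 ∖ ker κ`», true in class (iii)) corrects it by an
`ℓ ∈ 𝓛`, and the rescaled procyclic descent (`X11b.ProcyclicDescent.rescale`) lifts the corrected class to `H¹(D_𝔮, M)`.

CONTENT:
* §1 **`baseLift_unr_of_locSurj`** — (β)_nr ⟸ (LS) ∧ hul ∧ h𝓛: steps (2) all conjugates agree mod `S_nr`; (3) local lifts — strict ones at the finitely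
  many `w ∤ p` where the cocycle of `c` is ramified (through hul), the UNRAMIFIED one at `𝔮` (file 1), at every other `w ∤ p` the class is already
  unramified; (4) = (LS); (5) the corrected class `c − res g` lies in `S_nr`;
* §2 **`exists_conjUnr_sub_eq_of_subsingleton_H2_of_baseLift`** — `H²(Γ_K, M) = 0` ∧ (β)_nr ⟹ `conj_γ − 1` ONTO `S_nr` (Greenberg's chase, -w4 g8
  `exists_twist_eq_of_lift` with the full ambient and `u = 1`), and **`natCard_endCoinvariants_conjUnr_eq_one_of_baseLift`** (`#(S_nr)_Γ = 1`).
presearch: as file 1; no new fact. beyond-print theorem: no.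

References: [JetchevSkinnerWan2017] Lemma 3.3.3, Prop. 3.3.2; [GreenbergLNM1716] §4 Props. 4.13–4.15; [GreenbergVatsal2000] §2 pp. 17–21;
[Agboola2007] §3 Prop. 3.2, §5 Prop. 5.1; [SerreGaloisCohomology1997] I §2.5–2.6.
-/

noncomputable section

open scoped Classical

set_option linter.dupNamespace false
set_option autoImplicit false

open NumberField IsDedekindDomain Field WeierstrassCurve
open Literature.NumberTheory.EllipticCurves Literature.NumberTheory.EllipticCurves.GreenbergSelmer
open Literature.NumberTheory.EllipticCurves.GreenbergVatsal2000 Literature.NumberTheory.EllipticCurves.KellerYin2024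
open Literature.NumberTheory.EllipticCurves.Agboola2007
open Literature.NumberTheory.EllipticCurves.IwasawaDual
open Literature.NumberTheory.GaloisRepresentations
open Summit.BirchSwinnertonDyer.Rank1Residual.X11b
open Summit.BirchSwinnertonDyer.BirchSwinnertonDyer.Theorems.PrintCf2.RestrictedSelmerPair

namespace Summit.BirchSwinnertonDyer.BirchSwinnertonDyer.Theorems.PrintCf2.UnrBaseLift

/-! ## §1. (β)_nr: the base lift for `S_nr = H¹_{𝓕_nr}(K_∞, M)` from the level-`K` local surjectivity -/

section BaseLift

variable {K : Type} [Field K] [NumberField K] {p : ℕ} [Fact p.Prime] (κ : ZpExtension K p)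
  (M : Type) [AddCommGroup M] [DistribMulAction (absoluteGaloisGroup K) M] [TopologicalSpace M]
  [DiscreteTopology M] {𝔮 : HeightOneSpectrum (𝓞 K)}

/-- **(β)_nr — THE BASE LIFT FOR THE UNRAMIFIED LINE GROUP ⟸ (LS) ∧ hul ∧ h𝓛.** For a number field `K`, a `ℤ_p`-line `κ` with topological
generator `γ`, a discrete `p`-primary `Γ_K`-module `M` with open stabilisers and a place `𝔮 ∣ p`: GRANTED
 (LS)  the level-`K` local surjectivity of -w4 g9's `baseLift_of_locSurj` (finitely supported families of local classes at places `w ∤ p` or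
       `w = 𝔮` are hit EXACTLY by `H¹(Γ_K, M)`, with zero components at the other `w ∤ p`),
 (hul) «unramified ⟹ locally trivial» over the line at every `w ∤ p` (on road α: -w6 g4's `awayKer_eq_unramifiedKer_of_frame`),
 (h𝓛)  at `𝔮`: for every `δ ∈ D_𝔮` outside `ker κ`, `conj_δ − 1` maps the local defect group `𝓛 = {ℓ ∈ H¹(ker κ ∩ D_𝔮, M) | res_{ker κ ∩ I_𝔮} ℓ = 0}`
       onto itself (S3d's class (iii): `𝓛 ≅ W*` divisible, `δ` acting by a unit `≠ 1`),
every `c ∈ H¹(K_∞, M)` with `conj_γ c − c ∈ S_nr` is congruent modulo `S_nr` to a class restricted from `H¹(K, M)`. Steps: (2) all conjugates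
of `c` agree with `c` mod `S_nr` (`conjH1_sub_mem_of_isTopGenerator`); (3) local lifts — strict ones at the finitely many `w ∤ p` where the cocycle
of `c` is ramified (`exists_resSubgroup_kerD_eq_of_forall_local` through hul), the UNRAMIFIED one at `𝔮` (`exists_resOfLe_inertia_eq_of_unr` through
h𝓛); at every other `w ∤ p` the class is already unramified (`oneCocycleClass_mem_unramifiedKer_of_inertia_le`); (4) = (LS); (5) the corrected class
`c − res g` is in `S_nr` (`mem_unrSelmer_of_local`). [cite: JetchevSkinnerWan2017, Lemma 3.3.3 and Prop. 3.3.2 (arXiv:1512.06894 pp. 11–12)]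
[cite: GreenbergLNM1716, §4 pp. 122–125] [cite: GreenbergVatsal2000, §2 pp. 16–17] -/
theorem baseLift_unr_of_locSurj (h𝔮 : ((p : ℕ) : 𝓞 K) ∈ 𝔮.asIdeal)
    (hstab : ∀ m : M, IsOpen (MulAction.stabilizer (absoluteGaloisGroup K) m : Set (absoluteGaloisGroup K)))
    (htor : ∀ m : M, ∃ k : ℕ, p ^ k • m = 0) {γ : absoluteGaloisGroup K} (hγ : κ.IsTopGenerator γ)
    (hul : ∀ w : HeightOneSpectrum (𝓞 K), ((p : ℕ) : 𝓞 K) ∉ w.asIdeal →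
      unramifiedKer κ.kerSubgroup M w ≤ awayKer κ.kerSubgroup M w)
    (hL : ∀ δ : decomp (K := K) 𝔮, (δ : absoluteGaloisGroup K) ∉ κ.kerSubgroup →
      ∀ a : subgroupH1 (Coinv.kerD κ 𝔮) M,
        resH1Hom (Coinv.toKerD κ 𝔮 (kerSubgroup_inf_inertia_le_decomp κ 𝔮) (inf_le_left : κ.kerSubgroup ⊓ inertia 𝔮 ≤ κ.kerSubgroup))
          (AddMonoidHom.id M) (fun _ _ ↦ rfl) a = 0 →
        ∃ ℓ : subgroupH1 (Coinv.kerD κ 𝔮) M,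
          resH1Hom (Coinv.toKerD κ 𝔮 (kerSubgroup_inf_inertia_le_decomp κ 𝔮) (inf_le_left : κ.kerSubgroup ⊓ inertia 𝔮 ≤ κ.kerSubgroup))
            (AddMonoidHom.id M) (fun _ _ ↦ rfl) ℓ = 0 ∧
          conjH1 (Coinv.kerD κ 𝔮) M δ ℓ - ℓ = a)
    (hLS : ∀ (S : Finset (HeightOneSpectrum (𝓞 K))), (∀ w ∈ S, ((p : ℕ) : 𝓞 K) ∉ w.asIdeal ∨ w = 𝔮) →
      ∀ τ : (w : HeightOneSpectrum (𝓞 K)) → subgroupH1 (decomp (K := K) w) M,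
      ∃ g : discreteH1 (absoluteGaloisGroup K) M,
        (∀ w ∈ S, ResKernel.resSubgroup (decomp (K := K) w) M g = τ w) ∧
        (∀ w : HeightOneSpectrum (𝓞 K), w ∉ S → ((p : ℕ) : 𝓞 K) ∉ w.asIdeal →
          ResKernel.resSubgroup (decomp (K := K) w) M g = 0)) :
    ∀ c : subgroupH1 κ.kerSubgroup M, conjH1 κ.kerSubgroup M γ c - c ∈ unrSelmer κ M 𝔮 ∅ →
      ∃ z : subgroupH1 (⊤ : Subgroup (absoluteGaloisGroup K)) M,
        c - resOfLe M (le_top : κ.kerSubgroup ≤ ⊤) z ∈ unrSelmer κ M 𝔮 ∅ := by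
  intro c hc
  have hstab' : ∀ m : M, IsOpen {σ : absoluteGaloisGroup K | σ • m = m} := fun m ↦ hstab m
  -- (2) all conjugates of `c` agree with `c` modulo `S_nr`
  have hSel : ∀ g : absoluteGaloisGroup K, conjH1 κ.kerSubgroup M g c - c ∈ unrSelmer κ M 𝔮 ∅ :=
    conjH1_sub_mem_of_isTopGenerator κ M (unrSelmer κ M 𝔮 ∅) (fun g _ hc' ↦ conjH1_mem_unrSelmer κ M 𝔮 g hc') hstab hγ hc
  -- the cocycle of `c`, its zero set, the finite exceptional set
  obtain ⟨φ, hφ⟩ := oneCocycleClass_surjective _ c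
  obtain ⟨N₁, hN₁⟩ := Coinv.exists_openNormalSubgroup_forall_apply_eq_zero (K := K) φ
  set S' : Set (HeightOneSpectrum (𝓞 K)) := {w | ((p : ℕ) : 𝓞 K) ∉ w.asIdeal ∧
    ¬ (adicCompletionPrime K w).inertia (absoluteGaloisGroup K) ≤ (N₁ : Subgroup _)} with hS'
  have hS'fin : S'.Finite := by
    have hev := eventually_forall_inertia_le (N₁ : Subgroup (absoluteGaloisGroup K)) N₁.isOpen
    refine (Filter.eventually_cofinite.mp hev).subset fun w hw hall ↦ ?_
    exact hw.2 (hall _ (adicCompletionPrime_mem_primesAbove K w))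
  -- (3) local lifts: strict at `w ∤ p`, unramified at `𝔮`, in one uniform statement
  have hz : ∀ w : HeightOneSpectrum (𝓞 K), (((p : ℕ) : 𝓞 K) ∉ w.asIdeal ∨ w = 𝔮) →
      ∃ z : subgroupH1 (decomp (K := K) w) M,
        resOfLe M (kerSubgroup_inf_inertia_le_decomp κ w) z =
          resOfLe M (inf_le_left : κ.kerSubgroup ⊓ inertia w ≤ κ.kerSubgroup) c ∧
        (((p : ℕ) : 𝓞 K) ∉ w.asIdeal → ResKernel.resSubgroup (Coinv.kerD κ w) M z = Coinv.resKerD κ M w c) := by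
    intro w hw
    by_cases hpw : ((p : ℕ) : 𝓞 K) ∉ w.asIdeal
    · -- strict lift at `w ∤ p` (unramified = locally trivial over the line)
      have hloc : ∀ d : decomp (K := K) w,
          Coinv.resKerD κ M w (conjH1 κ.kerSubgroup M (d : absoluteGaloisGroup K) c - c) = 0 := fun d ↦
        (Coinv.mem_awayKer_iff_resKerD_eq_zero κ w _).1
          (hul w hpw (mem_unramifiedKer_of_mem_unrSelmer hpw (hSel d)))
      obtain ⟨z, hz⟩ := exists_resSubgroup_kerD_eq_of_forall_local hstab' htor w hloc
      refine ⟨z, ?_, fun _ ↦ hz⟩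
      rw [← toKerD_comp_resSubgroup κ M w, AddMonoidHom.comp_apply, hz, ← AddMonoidHom.comp_apply, toKerD_comp_resKerD]
    · -- `w = 𝔮`: the unramified lift
      have hwq : w = 𝔮 := hw.resolve_left hpw
      subst hwq
      have hinv : ∀ d : decomp (K := K) w,
          resOfLe M (inf_le_left : κ.kerSubgroup ⊓ inertia w ≤ κ.kerSubgroup)
            (conjH1 κ.kerSubgroup M (d : absoluteGaloisGroup K) c - c) = 0 := fun d ↦
        resOfLe_inertia_eq_zero_of_mem_unrSelmer h𝔮 (hSel d)
      obtain ⟨z, hz⟩ := exists_resOfLe_inertia_eq_of_unr hstab' htor hinv hL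
      exact ⟨z, hz, fun h ↦ (h h𝔮).elim⟩
  choose z hz using hz
  -- the finite set `S = S' ∪ {𝔮}` and the family
  set S : Finset (HeightOneSpectrum (𝓞 K)) := insert 𝔮 hS'fin.toFinset with hSdef
  have hSp : ∀ w ∈ S, ((p : ℕ) : 𝓞 K) ∉ w.asIdeal ∨ w = 𝔮 := by
    intro w hw
    rcases Finset.mem_insert.mp hw with rfl | hw'
    · exact Or.inr rfl
    · exact Or.inl ((Set.Finite.mem_toFinset _).mp hw').1
  let τ : (w : HeightOneSpectrum (𝓞 K)) → subgroupH1 (decomp (K := K) w) M :=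
    fun w ↦ if h : (((p : ℕ) : 𝓞 K) ∉ w.asIdeal ∨ w = 𝔮) then z w h else 0
  -- (4) = (LS): the global class
  obtain ⟨g, hgS, hg0⟩ := hLS S hSp τ
  refine ⟨resH1Hom (Literature.NumberTheory.EllipticCurves.subgroupIncl (⊤ : Subgroup (absoluteGaloisGroup K))) (AddMonoidHom.id M)
    (fun _ _ ↦ rfl) g, ?_⟩
  have hres : resOfLe M (le_top : κ.kerSubgroup ≤ ⊤)
      (resH1Hom (Literature.NumberTheory.EllipticCurves.subgroupIncl (⊤ : Subgroup (absoluteGaloisGroup K))) (AddMonoidHom.id M)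
        (fun _ _ ↦ rfl) g) = ResKernel.resSubgroup κ.kerSubgroup M g :=
    congrArg (fun f ↦ f g) (Summit.BirchSwinnertonDyer.Rank1Residual.X11b.AcSelmer.resOfLe_top_comp_resH1Hom_subgroupIncl
      (H := κ.kerSubgroup) (M := M))
  rw [hres]
  -- (5) the corrected class is in `S_nr`
  set y := c - ResKernel.resSubgroup κ.kerSubgroup M g with hy
  have hconj : ∀ σ : absoluteGaloisGroup K, conjH1 κ.kerSubgroup M σ y = y + (conjH1 κ.kerSubgroup M σ c - c) := by
    intro σ
    rw [hy, map_sub, Coinv.conjH1_resSubgroup]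
    abel
  -- unramified at every `w ∤ p`
  have haway : ∀ (w : HeightOneSpectrum (𝓞 K)), ((p : ℕ) : 𝓞 K) ∉ w.asIdeal → y ∈ unramifiedKer κ.kerSubgroup M w := by
    intro w hpw
    by_cases hwS : w ∈ S
    · -- matched local lift: `y` is even locally trivial at `w`
      refine LineLocallyTrivial.awayKer_le_unramifiedKer κ.kerSubgroup w ((Coinv.mem_awayKer_iff_resKerD_eq_zero κ w _).2 ?_)
      rw [hy, map_sub, Coinv.resKerD_resSubgroup, hgS w hwS]
      change Coinv.resKerD κ M w c - ResKernel.resSubgroup (Coinv.kerD κ w) M (if h : _ then z w h else 0) = 0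
      rw [dif_pos (Or.inl hpw), (hz w (Or.inl hpw)).2 hpw, sub_self]
    · -- `w ∉ S`: `res g = 0` at `w` and the cocycle of `c` is unramified at `w`
      have hwS' : w ∉ S' := fun h ↦ hwS (Finset.mem_insert_of_mem ((Set.Finite.mem_toFinset _).mpr h))
      have hI : (adicCompletionPrime K w).inertia (absoluteGaloisGroup K) ≤ (N₁ : Subgroup _) := by
        by_contra h; exact hwS' ⟨hpw, h⟩
      have hc0 : c ∈ unramifiedKer κ.kerSubgroup M w := by
        rw [← hφ]
        exact oneCocycleClass_mem_unramifiedKer_of_inertia_le κ φ hN₁ hI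
      have hg0' : ResKernel.resSubgroup κ.kerSubgroup M g ∈ unramifiedKer κ.kerSubgroup M w := by
        refine LineLocallyTrivial.awayKer_le_unramifiedKer κ.kerSubgroup w ((Coinv.mem_awayKer_iff_resKerD_eq_zero κ w _).2 ?_)
        rw [Coinv.resKerD_resSubgroup, hg0 w hwS hpw, map_zero]
      rw [hy]
      exact sub_mem hc0 hg0'
  -- unramified at `𝔮`
  have h𝔮S : 𝔮 ∈ S := Finset.mem_insert_self _ _
  have hq : resOfLe M (inf_le_left : κ.kerSubgroup ⊓ inertia 𝔮 ≤ κ.kerSubgroup) y = 0 := by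
    rw [hy, map_sub, ← AddMonoidHom.comp_apply (resOfLe M _) (ResKernel.resSubgroup κ.kerSubgroup M),
      ProcyclicDescent.resOfLe_comp_resSubgroup (A := M) (inf_le_left : κ.kerSubgroup ⊓ inertia 𝔮 ≤ κ.kerSubgroup),
      ← ProcyclicDescent.resOfLe_comp_resSubgroup (A := M) (kerSubgroup_inf_inertia_le_decomp κ 𝔮), AddMonoidHom.comp_apply,
      hgS 𝔮 h𝔮S]
    change resOfLe M _ c - resOfLe M _ (if h : _ then z 𝔮 h else 0) = 0
    rw [dif_pos (Or.inr rfl), (hz 𝔮 (Or.inr rfl)).1, sub_self]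
  refine mem_unrSelmer_of_local h𝔮 (fun w hpw σ ↦ ?_) (fun σ ↦ ?_)
  · rw [hconj]
    exact add_mem (haway w hpw) (mem_unramifiedKer_of_mem_unrSelmer hpw (hSel σ))
  · rw [hconj, map_add, hq, zero_add]
    exact resOfLe_inertia_eq_zero_of_mem_unrSelmer h𝔮 (hSel σ)

end BaseLift

/-! ## §2. `H²(Γ_K, M) = 0` ∧ (β)_nr ⟹ `conj_γ − 1` is ONTO `S_nr`, i.e. `(S_nr)_Γ = 0` -/

section Coinvariants

variable {K : Type} [Field K] [NumberField K] {p : ℕ} [Fact p.Prime] (κ : ZpExtension K p)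
  (M : Type) [AddCommGroup M] [DistribMulAction (absoluteGaloisGroup K) M] [TopologicalSpace M]
  [DiscreteTopology M] (𝔮 : HeightOneSpectrum (𝓞 K))

/-- **`H²(Γ_K, M) = 0` + (β)_nr ⟹ `conj_γ − 1` is onto `S_nr = H¹_{𝓕_nr}(K_∞, M)`** — Greenberg's chase (-w4 g8 `exists_twist_eq_of_lift`, ambient
`H¹(K_∞, M)`, `u = 1`): `conj_γ − 1` is onto `H¹(K_∞, M)` by the X11b procyclic descent (`exists_conjH1_sub_eq_of_subsingleton_H2`), and the lift
property is (β)_nr, the invariant correction being a class restricted from `K` (`conjH1_resOfLe_of_mem`). Hence `H¹(Γ, S_nr) = (S_nr)_Γ = 0`.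
[cite: JetchevSkinnerWan2017, Lemma 3.3.3] [cite: GreenbergLNM1716, §4 pp. 123–125] -/
theorem exists_conjUnr_sub_eq_of_subsingleton_H2_of_baseLift
    (hstab : ∀ m : M, IsOpen {g : absoluteGaloisGroup K | g • m = m})
    (htor : ∀ m : M, ∃ k : ℕ, p ^ k • m = 0) {γ : absoluteGaloisGroup K} (hγ : κ.IsTopGenerator γ)
    (h2 : Subsingleton (continuousCohomology 2 (discreteTopRep (absoluteGaloisGroup K) M)))
    (hbase : ∀ c : subgroupH1 κ.kerSubgroup M, conjH1 κ.kerSubgroup M γ c - c ∈ unrSelmer κ M 𝔮 ∅ →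
      ∃ z : subgroupH1 (⊤ : Subgroup (absoluteGaloisGroup K)) M,
        c - resOfLe M (le_top : κ.kerSubgroup ≤ ⊤) z ∈ unrSelmer κ M 𝔮 ∅)
    (s : unrSelmer κ M 𝔮 ∅) : ∃ t : unrSelmer κ M 𝔮 ∅, conjUnr κ M 𝔮 ∅ γ t - t = s := by
  set ψ : subgroupH1 κ.kerSubgroup M →+ subgroupH1 κ.kerSubgroup M := (conjH1 κ.kerSubgroup M γ) - AddMonoidHom.id _ with hψ
  have hψapp : ∀ c, ψ c = conjH1 κ.kerSubgroup M γ c - c := fun c ↦ by rw [hψ, AddMonoidHom.sub_apply, AddMonoidHom.id_apply]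
  obtain ⟨s', hs', hs'eq⟩ := exists_twist_eq_of_lift ψ ⊤ (unrSelmer κ M 𝔮 ∅)
    (fun x _ ↦ by
      obtain ⟨y, hy⟩ := exists_conjH1_sub_eq_of_subsingleton_H2 κ M hstab htor hγ h2 x
      exact ⟨y, AddSubgroup.mem_top y, by rw [hψapp]; exact hy⟩)
    (fun c _ hc ↦ by
      rw [hψapp] at hc
      obtain ⟨z, hz⟩ := hbase c hc
      refine ⟨resOfLe M (le_top : κ.kerSubgroup ≤ ⊤) z, AddSubgroup.mem_top _, ?_, hz⟩
      rw [hψapp, sub_eq_zero]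
      exact conjH1_resOfLe_of_mem M (le_top : κ.kerSubgroup ≤ ⊤) (Subgroup.mem_top γ) z)
    le_top s s.2
  refine ⟨⟨s', hs'⟩, Subtype.ext ?_⟩
  rw [AddSubgroupClass.coe_sub]
  change conjH1 κ.kerSubgroup M γ s' - s' = s
  rw [← hψapp]
  exact hs'eq

/-- **`#(S_nr)_Γ = 1`**: `H¹(Γ, H¹_{𝓕_nr}(K_∞, M)) = 0` under `H²(Γ_K, M) = 0` and (β)_nr (the `nr` twin of B17's
`natCard_endCoinvariants_eq_one_of_frame_of_baseLift`). With -w3 g11's spine this is the input «`Q_Γ = 0`» (`Q = S_nr ⧸ 𝔖` is a quotient of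
`S_nr`) of S3d on class (iii). [cite: JetchevSkinnerWan2017, Lemma 3.3.3] [cite: GreenbergLNM1716, §4 Props. 4.14–4.15] -/
theorem natCard_endCoinvariants_conjUnr_eq_one_of_baseLift
    (hstab : ∀ m : M, IsOpen {g : absoluteGaloisGroup K | g • m = m})
    (htor : ∀ m : M, ∃ k : ℕ, p ^ k • m = 0) {γ : absoluteGaloisGroup K} (hγ : κ.IsTopGenerator γ)
    (h2 : Subsingleton (continuousCohomology 2 (discreteTopRep (absoluteGaloisGroup K) M)))
    (hbase : ∀ c : subgroupH1 κ.kerSubgroup M, conjH1 κ.kerSubgroup M γ c - c ∈ unrSelmer κ M 𝔮 ∅ →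
      ∃ z : subgroupH1 (⊤ : Subgroup (absoluteGaloisGroup K)) M,
        c - resOfLe M (le_top : κ.kerSubgroup ≤ ⊤) z ∈ unrSelmer κ M 𝔮 ∅) :
    Nat.card (EndCoinvariants (conjUnr κ M 𝔮 ∅ γ - 1)) = 1 := by
  haveI : Subsingleton (EndCoinvariants (conjUnr κ M 𝔮 ∅ γ - 1)) := by
    refine ⟨fun a b ↦ ?_⟩
    obtain ⟨a, rfl⟩ := QuotientAddGroup.mk_surjective a
    obtain ⟨b, rfl⟩ := QuotientAddGroup.mk_surjective b
    have ha : ((a : unrSelmer κ M 𝔮 ∅) : EndCoinvariants (conjUnr κ M 𝔮 ∅ γ - 1)) = 0 := by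
      obtain ⟨t, ht⟩ := exists_conjUnr_sub_eq_of_subsingleton_H2_of_baseLift κ M 𝔮 hstab htor hγ h2 hbase a
      exact (endCoinvariants_mk_eq_zero_iff _ a).2 ⟨t, by rw [IwasawaDual.End_sub_apply, AddMonoid.End.one_apply]; exact ht⟩
    have hb : ((b : unrSelmer κ M 𝔮 ∅) : EndCoinvariants (conjUnr κ M 𝔮 ∅ γ - 1)) = 0 := by
      obtain ⟨t, ht⟩ := exists_conjUnr_sub_eq_of_subsingleton_H2_of_baseLift κ M 𝔮 hstab htor hγ h2 hbase b
      exact (endCoinvariants_mk_eq_zero_iff _ b).2 ⟨t, by rw [IwasawaDual.End_sub_apply, AddMonoid.End.one_apply]; exact ht⟩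
    exact ha.trans hb.symm
  exact Nat.card_of_subsingleton 0

end Coinvariants


end Summit.BirchSwinnertonDyer.BirchSwinnertonDyer.Theorems.PrintCf2.UnrBaseLift

end
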